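import Summits.BirchSwinnertonDyer.BirchSwinnertonDyer.Theorems.KimAtThreeDeepUpperOfKatoPrint
import HarnessLib

/-!
# Crux `DeepUpperAtThree` (19076) and the deep leaf of W2 BY NAME from the four cite leaves, FIVE cite facts and the
# PRINT-SHAPED Kato package hKatoPᵘ (sequel to `KimAtThreeDeepUpperOfKatoPrint`; route `KimAtThreeKolyvagin`, rung W2;
# cell `bsd-addord`, seat w2-c3 gen 9; `--supports 19076`, helper)

HONEST FRAMING.  Glue theorems only; hKatoPᵘ (text = `KimAtThreeDeepUpperOfKatoPrint` VERBATIM) is a DISPLAYED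
hypothesis; the leaves and the five `DualExpElliptic(-Tower)` facts are cite-only named facts taken as binders; every
conclusion is a route decl BY NAME but CONDITIONAL; nothing is closed or booked; BSD is not proved by any of this.

READING OF RECORD proposed for crux 19076 (and 19075 / 19679 / 19562 / 20013 / `N11.KimAtThreeDeepPUB`):
  ⟸ {`SakamotoKolyvaginThree`, `RankEqAnalyticRankLeOne`, `PoitouTateSelmerDuality`, `CarayolLevelEqConductor`} (cite)
  ∧ {`cupLogInjective_and_hasDualExp_of_isDeRham`, `isDeRham_restrictedRationalTateRep`, `expStarCoord_eq_zero_iff_kummer`,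
     `exists_smul_range_expStarCoord_iff_trace_log`, `exists_smul_range_expStarCoord_tower_iff_trace_log`} (cite)
  ∧ **hKatoPᵘ** — Kato, Astérisque 295 (2004): (8.1.3)/Prop. 8.12/Ex. 13.3 [(C1) Euler system], §8.2–Lemma 8.5 [(C2)
  unramified away from 3], Thm. 9.7 [(C4) the DEFINED semi-local dual exponential `katoLambda` (w2-acc5) of the zeta
  element is RATIONAL], Thm. 6.6 (1) [(C5) value law] — over DEFINED objects, with NO abstract value datum, NO pinning
  clause and NO own-attribution clause left (composition `KimAtThreeDeepUpperOfKatoPrint.katoExact_of_katoPrint_of_facts`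
  ∘ w2-c2's `KimAtThreeDeepLowerKatoExactFinal`).

References: [Kato2004Asterisque] (8.1.3) p. 180, Prop. 8.12 p. 186, §9.4 / Thm. 9.7 pp. 188–189, Thm. 6.6 (1) p. 163,
Ex. 13.3 p. 225; [Kato1993LNM1553] II Prop. 1.2.3, §1.2.4, Thm. 1.4.1; [BlochKato1990] §3 Prop. 3.8, Ex. 3.11;
[Kim2025RefinedTNC] Thm. 1.1; [Sakamoto2024] Thm. 4.4; [MazurRubin2004] Thm. 5.2.12; [Carayol1986].
-/

noncomputable section


-- the cell's Theorems namespace `Summit.BirchSwinnertonDyer.BirchSwinnertonDyer.…` repeats the summit name by design (D-0017)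
set_option linter.dupNamespace false

open scoped Classical NumberField TensorProduct ContRepresentation Pointwise
open Field ValuativeRel Function IsDedekindDomain NumberField
open WeierstrassCurve Literature.NumberTheory.EllipticCurves Literature.NumberTheory.GaloisRepresentations
  Literature.NumberTheory.GaloisRepresentations.DiscreteGaloisModule Literature.NumberTheory.GaloisCohomology
open Literature.NumberTheory.GaloisRepresentations.PeriodRingData Literature.NumberTheory.PAdicHodge
open Literature.NumberTheory.EllipticCurves.ModularForms Literature.NumberTheory.EllipticCurves.Rank1Residual
open Literature.NumberTheory.EllipticCurves.Kato2004 Literature.NumberTheory.EllipticCurves.Kato2004.EulerSystemValues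
open Literature.NumberTheory.AdelicBaseChange Literature.NumberTheory.Automorphic
open Summit.BirchSwinnertonDyer.Rank1Residual.GaloisImage
open Summit.BirchSwinnertonDyer.Rank1Residual.Additive
open Summit.BirchSwinnertonDyer.Rank1Residual.Additive.LocalLog
open Summit.BirchSwinnertonDyer.BirchSwinnertonDyer.Theses.KimAtThreeKolyvagin
open Summit.BirchSwinnertonDyer.BirchSwinnertonDyer.Theorems
open Summit.BirchSwinnertonDyer.BirchSwinnertonDyer.Theorems.KimAtThreeFineKatoPerFactorDefined
open Summit.BirchSwinnertonDyer.BirchSwinnertonDyer.Theorems.KimAtThreeFineKatoLevelCompat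
open Summit.BirchSwinnertonDyer.BirchSwinnertonDyer.Theorems.KimAtThreeFineKatoLevelCompatDef
open Summit.BirchSwinnertonDyer.BirchSwinnertonDyer.Theorems.KimAtThreeDeepLowerExpStarOmega
open Summit.BirchSwinnertonDyer.BirchSwinnertonDyer.Theorems.KimAtThreeDeepLowerExpStarOmegaPlace
open Summit.BirchSwinnertonDyer.BirchSwinnertonDyer.Theorems.KimAtThreeFineKatoPerFactorPlaces
open Summit.BirchSwinnertonDyer.BirchSwinnertonDyer.Theorems.KimAtThreeDeepUpperExpStarFacts
open Summit.BirchSwinnertonDyer.BirchSwinnertonDyer.Theorems.KimAtThreeFineKatoPrintClauses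
open Summit.BirchSwinnertonDyer.BirchSwinnertonDyer.Theorems.KimAtThreeDeepUpperZetaBodyC3Uniform
open Summit.BirchSwinnertonDyer.BirchSwinnertonDyer.Theorems.KimAtThreeDeepUpperZetaBodyC3UniformFacts
open Summit.BirchSwinnertonDyer.BirchSwinnertonDyer.Theorems.KimAtThreeFineKatoDefinedLambda
open Summit.BirchSwinnertonDyer.BirchSwinnertonDyer.Theorems.KimAtThreeDeepLowerKatoExactFinal

open Summit.BirchSwinnertonDyer.BirchSwinnertonDyer.Theorems.KimAtThreeDeepUpperOfKatoPrint

namespace Summit.BirchSwinnertonDyer.BirchSwinnertonDyer.Theorems.KimAtThreeDeepUpperOfKatoPrintCrux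

variable
    (hKatoP : ∀ (W : WeierstrassCurve ℚ) [W.IsElliptic] [W.IsGloballyMinimal]
      [ContinuousSMul ℤ_[3] (W.tateModule 3)] [Module.Free ℤ_[3] (W.tateModule 3)]
      [Module.Finite ℤ_[3] (W.tateModule 3)],
      (∀ m : ℕ, W.HasSurjectiveModNGaloisRep (3 ^ m : ℕ)) →
      ∀ {N : ℕ} [NeZero N] (P : ModularParametrizationData W N), N = W.conductorNorm ℤ →
        (∀ z ∈ P.L.lattice, ∃ w ∈ periodLattice P.f, z = P.c * w) →
        haveI : Fact (((3 : ℕ) : 𝓞 ℚ) ∈ ((Rat.HeightOneSpectrum.primesEquiv (R := 𝓞 ℚ)).symm ⟨3, Fact.out⟩).asIdeal) :=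
          ⟨(natCast_mem_asIdeal_iff_eq_primesEquiv_symm _ Nat.prime_three).mpr rfl⟩
        letI := valuativeRelPlace ((Rat.HeightOneSpectrum.primesEquiv (R := 𝓞 ℚ)).symm ⟨3, Fact.out⟩)
        letI := topologicalSpacePlace ((Rat.HeightOneSpectrum.primesEquiv (R := 𝓞 ℚ)).symm ⟨3, Fact.out⟩)
        haveI := isNonarchimedeanLocalField_place ((Rat.HeightOneSpectrum.primesEquiv (R := 𝓞 ℚ)).symm ⟨3, Fact.out⟩)
        haveI := charZero_place ((Rat.HeightOneSpectrum.primesEquiv (R := 𝓞 ℚ)).symm ⟨3, Fact.out⟩)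
        letI := padicAlgebraPlace 3 ((Rat.HeightOneSpectrum.primesEquiv (R := 𝓞 ℚ)).symm ⟨3, Fact.out⟩)
        haveI := fact_not_isUnit_place 3 ((Rat.HeightOneSpectrum.primesEquiv (R := 𝓞 ℚ)).symm ⟨3, Fact.out⟩)
        haveI := isAdicComplete_place 3 ((Rat.HeightOneSpectrum.primesEquiv (R := 𝓞 ℚ)).symm ⟨3, Fact.out⟩)
        ∃ (dK : LocalNeronLineAt W 3 ((Rat.HeightOneSpectrum.primesEquiv (R := 𝓞 ℚ)).symm ⟨3, Fact.out⟩))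
          (ι : (n : ℕ) → (CyclotomicField n ℚ →+* ℂ)) (κK : ℝ)
          (w₀ : ∀ (k : ℕ) (r : Finset (HeightOneSpectrum (𝓞 ℚ))), (((Rat.HeightOneSpectrum.primesEquiv (R := 𝓞 ℚ)).symm ⟨3, Fact.out⟩).Extension (𝓞 (CyclotomicField (cycLevel 3 k r) ℚ))))
          (Ψ : ∀ (k : ℕ) (r : Finset (HeightOneSpectrum (𝓞 ℚ))), ℚ_[3] ⊗[ℚ] CyclotomicField (cycLevel 3 k r) ℚ ≃ₐ[ℚ]
            (Π w : (((Rat.HeightOneSpectrum.primesEquiv (R := 𝓞 ℚ)).symm ⟨3, Fact.out⟩).Extension (𝓞 (CyclotomicField (cycLevel 3 k r) ℚ))), w.1.adicCompletion (CyclotomicField (cycLevel 3 k r) ℚ)))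
          (hΨ : ∀ (k : ℕ) (r : Finset (HeightOneSpectrum (𝓞 ℚ))) (s : ℚ_[3]) (x : CyclotomicField (cycLevel 3 k r) ℚ) (w : (((Rat.HeightOneSpectrum.primesEquiv (R := 𝓞 ℚ)).symm ⟨3, Fact.out⟩).Extension (𝓞 (CyclotomicField (cycLevel 3 k r) ℚ)))),
            Ψ k r (s ⊗ₜ[ℚ] x) w =
              algebraMap (CyclotomicField (cycLevel 3 k r) ℚ) (w.1.adicCompletion (CyclotomicField (cycLevel 3 k r) ℚ)) x *
              algebraMap (((Rat.HeightOneSpectrum.primesEquiv (R := 𝓞 ℚ)).symm ⟨3, Fact.out⟩).adicCompletion ℚ) (w.1.adicCompletion (CyclotomicField (cycLevel 3 k r) ℚ))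
                ((Padic.adicCompletionEquiv (𝓞 ℚ) ⟨3, Fact.out⟩) s))
          (g : ∀ (k : ℕ) (r : Finset (HeightOneSpectrum (𝓞 ℚ))), (((Rat.HeightOneSpectrum.primesEquiv (R := 𝓞 ℚ)).symm ⟨3, Fact.out⟩).Extension (𝓞 (CyclotomicField (cycLevel 3 k r) ℚ))) → absoluteGaloisGroup ℚ)
          (hg : ∀ (k : ℕ) (r : Finset (HeightOneSpectrum (𝓞 ℚ))) (w : (((Rat.HeightOneSpectrum.primesEquiv (R := 𝓞 ℚ)).symm ⟨3, Fact.out⟩).Extension (𝓞 (CyclotomicField (cycLevel 3 k r) ℚ)))),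
            sigma (cycLevel 3 k r) (modNCyclotomicCharacter ℚ (cycLevel 3 k r) (g k r w)) • w.1 = (w₀ k r).1)
          (dw : ∀ (k : ℕ) (r : Finset (HeightOneSpectrum (𝓞 ℚ))),
            letI := LocalField.charZero_adicCompletion (w₀ k r).1
            letI := LocalField.adicCompletionPadicAlgebra (w₀ k r).1 3 (three_mem_asIdeal_extension _ (w₀ k r))
            haveI : Fact (¬ IsUnit ((3 : ℕ) : integerC ((w₀ k r).1.adicCompletion (CyclotomicField (cycLevel 3 k r) ℚ)))) :=
              ⟨not_isUnit_natCast_integerC (LocalField.valuation_adicCompletion_natCast_lt_one (w₀ k r).1 3 (three_mem_asIdeal_extension _ (w₀ k r)))⟩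
            haveI := isAdicComplete_integerC_natCast (LocalField.valuation_adicCompletion_natCast_lt_one (w₀ k r).1 3 (three_mem_asIdeal_extension _ (w₀ k r)))
            LocalNeronLine W (LocalField.valuation_adicCompletion_natCast_lt_one (w₀ k r).1 3 (three_mem_asIdeal_extension _ (w₀ k r))) ((galRestrictPlace ((Rat.HeightOneSpectrum.primesEquiv (R := 𝓞 ℚ)).symm ⟨3, Fact.out⟩)).comp (absGaloisRestrict (((Rat.HeightOneSpectrum.primesEquiv (R := 𝓞 ℚ)).symm ⟨3, Fact.out⟩).adicCompletion ℚ) ((w₀ k r).1.adicCompletion (CyclotomicField (cycLevel 3 k r) ℚ)))))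
          (hinjw : ∀ (k : ℕ) (r : Finset (HeightOneSpectrum (𝓞 ℚ))),
            letI := LocalField.charZero_adicCompletion (w₀ k r).1
            letI := LocalField.adicCompletionPadicAlgebra (w₀ k r).1 3 (three_mem_asIdeal_extension _ (w₀ k r))
            haveI : Fact (¬ IsUnit ((3 : ℕ) : integerC ((w₀ k r).1.adicCompletion (CyclotomicField (cycLevel 3 k r) ℚ)))) :=
              ⟨not_isUnit_natCast_integerC (LocalField.valuation_adicCompletion_natCast_lt_one (w₀ k r).1 3 (three_mem_asIdeal_extension _ (w₀ k r)))⟩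
            haveI := isAdicComplete_integerC_natCast (LocalField.valuation_adicCompletion_natCast_lt_one (w₀ k r).1 3 (three_mem_asIdeal_extension _ (w₀ k r)))
            (bdRPeriodRingData (LocalField.valuation_adicCompletion_natCast_lt_one (w₀ k r).1 3 (three_mem_asIdeal_extension _ (w₀ k r)))).CupLogInjective (logCyclotomic 3) (localRationalTateRep W 3 ((galRestrictPlace ((Rat.HeightOneSpectrum.primesEquiv (R := 𝓞 ℚ)).symm ⟨3, Fact.out⟩)).comp (absGaloisRestrict (((Rat.HeightOneSpectrum.primesEquiv (R := 𝓞 ℚ)).symm ⟨3, Fact.out⟩).adicCompletion ℚ) ((w₀ k r).1.adicCompletion (CyclotomicField (cycLevel 3 k r) ℚ))))))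
          (hexw : ∀ (k : ℕ) (r : Finset (HeightOneSpectrum (𝓞 ℚ))),
            letI := LocalField.charZero_adicCompletion (w₀ k r).1
            letI := LocalField.adicCompletionPadicAlgebra (w₀ k r).1 3 (three_mem_asIdeal_extension _ (w₀ k r))
            haveI : Fact (¬ IsUnit ((3 : ℕ) : integerC ((w₀ k r).1.adicCompletion (CyclotomicField (cycLevel 3 k r) ℚ)))) :=
              ⟨not_isUnit_natCast_integerC (LocalField.valuation_adicCompletion_natCast_lt_one (w₀ k r).1 3 (three_mem_asIdeal_extension _ (w₀ k r)))⟩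
            haveI := isAdicComplete_integerC_natCast (LocalField.valuation_adicCompletion_natCast_lt_one (w₀ k r).1 3 (three_mem_asIdeal_extension _ (w₀ k r)))
            ∀ z : contOneCocycles (localRationalTateRep W 3 ((galRestrictPlace ((Rat.HeightOneSpectrum.primesEquiv (R := 𝓞 ℚ)).symm ⟨3, Fact.out⟩)).comp (absGaloisRestrict (((Rat.HeightOneSpectrum.primesEquiv (R := 𝓞 ℚ)).symm ⟨3, Fact.out⟩).adicCompletion ℚ) ((w₀ k r).1.adicCompletion (CyclotomicField (cycLevel 3 k r) ℚ))))).toTopRep,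
              (bdRPeriodRingData (LocalField.valuation_adicCompletion_natCast_lt_one (w₀ k r).1 3 (three_mem_asIdeal_extension _ (w₀ k r)))).HasDualExp (logCyclotomic 3) (localRationalTateRep W 3 ((galRestrictPlace ((Rat.HeightOneSpectrum.primesEquiv (R := 𝓞 ℚ)).symm ⟨3, Fact.out⟩)).comp (absGaloisRestrict (((Rat.HeightOneSpectrum.primesEquiv (R := 𝓞 ℚ)).symm ⟨3, Fact.out⟩).adicCompletion ℚ) ((w₀ k r).1.adicCompletion (CyclotomicField (cycLevel 3 k r) ℚ))))) fun σ => z.1 σ),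
          κK ≠ 0 ∧
          (∀ (k : ℕ) (r : Finset (HeightOneSpectrum (𝓞 ℚ))),
            letI := LocalField.charZero_adicCompletion (w₀ k r).1
            letI := LocalField.adicCompletionPadicAlgebra (w₀ k r).1 3 (three_mem_asIdeal_extension _ (w₀ k r))
            haveI : Fact (¬ IsUnit ((3 : ℕ) : integerC ((w₀ k r).1.adicCompletion (CyclotomicField (cycLevel 3 k r) ℚ)))) :=
              ⟨not_isUnit_natCast_integerC (LocalField.valuation_adicCompletion_natCast_lt_one (w₀ k r).1 3 (three_mem_asIdeal_extension _ (w₀ k r)))⟩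
            haveI := isAdicComplete_integerC_natCast (LocalField.valuation_adicCompletion_natCast_lt_one (w₀ k r).1 3 (three_mem_asIdeal_extension _ (w₀ k r)))
            ∀ (h : (tateLocalRep W 3 (Sum.inr ((Rat.HeightOneSpectrum.primesEquiv (R := 𝓞 ℚ)).symm ⟨3, Fact.out⟩))).cohomology 1),
              expStarOmegaHom (LocalField.valuation_adicCompletion_natCast_lt_one (w₀ k r).1 3 (three_mem_asIdeal_extension _ (w₀ k r))) ((galRestrictPlace ((Rat.HeightOneSpectrum.primesEquiv (R := 𝓞 ℚ)).symm ⟨3, Fact.out⟩)).comp (absGaloisRestrict (((Rat.HeightOneSpectrum.primesEquiv (R := 𝓞 ℚ)).symm ⟨3, Fact.out⟩).adicCompletion ℚ) ((w₀ k r).1.adicCompletion (CyclotomicField (cycLevel 3 k r) ℚ)))) (dw k r) (hinjw k r) (hexw k r)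
                (ContinuousRep.cohomologyRes (tateLocalRep W 3 (Sum.inr ((Rat.HeightOneSpectrum.primesEquiv (R := 𝓞 ℚ)).symm ⟨3, Fact.out⟩)))
                  (absGaloisRestrict (((Rat.HeightOneSpectrum.primesEquiv (R := 𝓞 ℚ)).symm ⟨3, Fact.out⟩).adicCompletion ℚ) ((w₀ k r).1.adicCompletion (CyclotomicField (cycLevel 3 k r) ℚ))) 1 h) =
              algebraMap (((Rat.HeightOneSpectrum.primesEquiv (R := 𝓞 ℚ)).symm ⟨3, Fact.out⟩).adicCompletion ℚ) ((w₀ k r).1.adicCompletion (CyclotomicField (cycLevel 3 k r) ℚ)) (expStarOmegaAt dK h)) ∧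
          ∀ (c d a : ℤ) (A : ℕ), 0 < A → Int.gcd c (6 * 3 * A) = 1 → Int.gcd d (6 * 3 * N) = 1 →
            ∃ (z : ∀ (k' : ℕ) (r : (cyclotomicLevelsRat 3 (badPlaces c d A N)).Ideals),
                  H1 (tateRep W 3) ((cyclotomicLevelsRat 3 (badPlaces c d A N)).level k' r.1))
              (x : ∀ (k' : ℕ) (r : (cyclotomicLevelsRat 3 (badPlaces c d A N)).Ideals),
                  CyclotomicField (cycLevel 3 k' r.1) ℚ),
              -- (C1) Euler system [Kato 2004 (8.1.3), Prop. 8.12, Ex. 13.3]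
              IsEulerSystem (cyclotomicLevelsRat 3 (badPlaces c d A N)) (tateRep W 3) 3 z ∧
              -- (C2) unramified away from 3 [Kato 2004 (8.1.3), §8.2, Lemma 8.5]
              (∀ (k : ℕ) (r : (cyclotomicLevelsRat 3 (badPlaces c d A N)).Ideals) (v : HeightOneSpectrum (𝓞 ℚ)), ((Rat.HeightOneSpectrum.primesEquiv v : Nat.Primes) : ℕ) ≠ 3 →
                  ∀ 𝔓 ∈ v.primesAbove,
                    resLe (tateRep W 3).toTopRep
                        (inf_le_left : (cyclotomicLevelsRat 3 (badPlaces c d A N)).level k r.1 ⊓ 𝔓.inertia (absoluteGaloisGroup ℚ) ≤ (cyclotomicLevelsRat 3 (badPlaces c d A N)).level k r.1)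
                        1 (z k r) = 0) ∧
              -- (C4) Kato's Thm. 9.7 for the DEFINED value datum `katoLambda` (single completion, twist family)
              (∀ (k : ℕ) (r : (cyclotomicLevelsRat 3 (badPlaces c d A N)).Ideals),
                katoLambda W 3 k r.1 (w₀ k r.1) (Ψ k r.1) (hΨ k r.1) (three_mem_asIdeal_extension _ (w₀ k r.1))
                  (g k r.1) (hg k r.1) (dw k r.1) (hinjw k r.1) (hexw k r.1) (z k r) = (1 : ℚ_[3]) ⊗ₜ[ℚ] x k r) ∧
              -- (C5) the value law [Kato 2004 Thm. 9.7 ∘ Thm. 6.6 (1)]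
              (∀ (k : ℕ) (r : (cyclotomicLevelsRat 3 (badPlaces c d A N)).Ideals) (d' : ℤ) (χ : DirichletCharacter ℂ (cycLevel 3 k r.1)) (Lχ : ℂ → ℂ),
                  Int.gcd (c * d) (cycLevel 3 k r.1 * A) = 1 →
                  d * d' ≡ 1 [ZMOD (A : ℤ)] →
                  IsDepletedTwistedL P.f (cycLevel 3 k r.1) (3 * A) χ Lχ →
                    (χ (-1) = 1 →
                      charSum (cycLevel 3 k r.1) (ι (cycLevel 3 k r.1)) χ (x k r) =
                        (κK : ℂ) * (Lχ 1 / (plusPeriod P.f : ℂ)) *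
                          cuspFactor P.f true (fun n ↦ χ⁻¹ (n : ZMod (cycLevel 3 k r.1))) c d a A d') ∧
                    (χ (-1) = -1 →
                      charSum (cycLevel 3 k r.1) (ι (cycLevel 3 k r.1)) χ (x k r) =
                        -(κK : ℂ) * (Lχ 1 / (Complex.I * (minusPeriod P.f : ℂ))) *
                          cuspFactor P.f false (fun n ↦ χ⁻¹ (n : ZMod (cycLevel 3 k r.1))) c d a A d')))

/-! ### §2 The deep leaf of W2 BY NAME from cite facts and hKatoPᵘ -/

variable (hSak : SakamotoKolyvaginThree) (hGZK : RankEqAnalyticRankLeOne) (hPT : PoitouTateSelmerDuality)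

include hKatoP in
/-- **Item `DefinedKatoUniformThree` (20013) BY NAME from the FIVE cite facts and hKatoPᵘ.** Conditional.
[cite: Kato2004Asterisque, §9.4 and Thm. 9.7 (pp. 188–189)] [cite: BlochKato1990, §3 (Prop. 3.8, Ex. 3.11)]
[cite: Kato1993LNM1553, Ch. II Prop. 1.2.3 and Thm. 1.4.1] -/
theorem definedKatoUniformThree_of_katoPrint_of_facts (hP : cupLogInjective_and_hasDualExp_of_isDeRham)
    (hDR : isDeRham_restrictedRationalTateRep) (hT : exists_smul_range_expStarCoord_iff_trace_log)
    (hS : expStarCoord_eq_zero_iff_kummer) (hT₂ : exists_smul_range_expStarCoord_tower_iff_trace_log) :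
    DefinedKatoUniformThree :=
  definedKatoUniformThree_of_katoExact_of_facts (katoExact_of_katoPrint_of_facts hKatoP hP hDR hT) hP hDR hS hT hT₂

include hKatoP hSak hGZK hPT in
/-- ★ **Crux `DeepUpperAtThree` (19076) BY NAME from the four leaves, the FIVE cite facts and hKatoPᵘ** — the Kato side
of the crux is PRINT over DEFINED objects. Conditional; nothing booked. [cite: Kim2025RefinedTNC, Thm 1.1]
[cite: Sakamoto2024, Thm. 4.4 (1)(2) (p. 926)] [cite: Carayol1986] [cite: Kato2004Asterisque, (8.1.3), Prop. 8.12, Thm. 9.7, Thm. 6.6 (1), Ex. 13.3] -/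
theorem deepUpperAtThree_of_katoPrint_of_facts (hP : cupLogInjective_and_hasDualExp_of_isDeRham)
    (hDR : isDeRham_restrictedRationalTateRep) (hT : exists_smul_range_expStarCoord_iff_trace_log)
    (hS : expStarCoord_eq_zero_iff_kummer) (hT₂ : exists_smul_range_expStarCoord_tower_iff_trace_log)
    (hlev : CarayolLevelEqConductor) :
    Summit.BirchSwinnertonDyer.BirchSwinnertonDyer.Theses.KimAtThreeKolyvagin.DeepUpperAtThree :=
  (deepLower_and_deepUpper_of_katoExact_of_facts (katoExact_of_katoPrint_of_facts hKatoP hP hDR hT)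
    hSak hGZK hPT hP hDR hS hT hT₂ hlev).2

include hKatoP hSak hGZK hPT in
/-- **Crux `DeepLowerAtThree` (19075) BY NAME from the four leaves, the FIVE cite facts and hKatoPᵘ.** Conditional.
[cite: Kim2025RefinedTNC, Thm 1.1] [cite: Sakamoto2024, Thm. 4.4 (1)(2) (p. 926)] [cite: Kato2004Asterisque, Thm. 9.7 (p. 189)] -/
theorem deepLowerAtThree_of_katoPrint_of_facts (hP : cupLogInjective_and_hasDualExp_of_isDeRham)
    (hDR : isDeRham_restrictedRationalTateRep) (hT : exists_smul_range_expStarCoord_iff_trace_log)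
    (hS : expStarCoord_eq_zero_iff_kummer) (hT₂ : exists_smul_range_expStarCoord_tower_iff_trace_log)
    (hlev : CarayolLevelEqConductor) :
    Summit.BirchSwinnertonDyer.BirchSwinnertonDyer.Theses.KimAtThreeKolyvagin.DeepLowerAtThree :=
  deepLowerAtThree_of_katoExact_of_facts (katoExact_of_katoPrint_of_facts hKatoP hP hDR hT)
    hSak hGZK hPT hP hDR hS hT hT₂ hlev

include hKatoP hSak hGZK hPT in
/-- **Crux `DeepUpperAtThreeOffKatoStratum` (19562) BY NAME** (no Carayol). Conditional.
[cite: Kim2025RefinedTNC, Thm 1.1] [cite: Sakamoto2024, Thm. 4.4 (1)(2) (p. 926)] -/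
theorem deepUpperAtThreeOffKatoStratum_of_katoPrint_of_facts (hP : cupLogInjective_and_hasDualExp_of_isDeRham)
    (hDR : isDeRham_restrictedRationalTateRep) (hT : exists_smul_range_expStarCoord_iff_trace_log)
    (hS : expStarCoord_eq_zero_iff_kummer) (hT₂ : exists_smul_range_expStarCoord_tower_iff_trace_log) :
    Summit.BirchSwinnertonDyer.BirchSwinnertonDyer.Theses.KimAtThreeKolyvagin.DeepUpperAtThreeOffKatoStratum :=
  deepUpperAtThreeOffKatoStratum_of_katoExact_of_facts (katoExact_of_katoPrint_of_facts hKatoP hP hDR hT)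
    hSak hGZK hPT hP hDR hS hT hT₂

include hKatoP hSak hGZK hPT in
/-- **Crux `DeepLowerAtThreeOffKatoStratum` (19679) BY NAME** (no Carayol). Conditional.
[cite: Kim2025RefinedTNC, Thm 1.1] [cite: Sakamoto2024, Thm. 4.4 (1)(2) (p. 926)] -/
theorem deepLowerAtThreeOffKatoStratum_of_katoPrint_of_facts (hP : cupLogInjective_and_hasDualExp_of_isDeRham)
    (hDR : isDeRham_restrictedRationalTateRep) (hT : exists_smul_range_expStarCoord_iff_trace_log)
    (hS : expStarCoord_eq_zero_iff_kummer) (hT₂ : exists_smul_range_expStarCoord_tower_iff_trace_log) :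
    Summit.BirchSwinnertonDyer.BirchSwinnertonDyer.Theses.KimAtThreeKolyvagin.DeepLowerAtThreeOffKatoStratum :=
  deepLowerAtThreeOffKatoStratum_of_katoExact_of_facts (katoExact_of_katoPrint_of_facts hKatoP hP hDR hT)
    hSak hGZK hPT hP hDR hS hT hT₂

include hKatoP hSak hGZK hPT in
/-- ★★ **`N11.KimAtThreeDeepPUB` (the deep leaf of W2) BY NAME from the four leaves, the FIVE cite facts and hKatoPᵘ.**
Conditional; nothing booked. [cite: Kim2025RefinedTNC, Thm 1.1] [cite: Kim2022StructureSelmer, Thm. 1.9 (6), Thm. 3.13]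
[cite: Kato2004Asterisque, Thm. 9.7 (p. 189) and Thm. 6.6 (1) (p. 163)] [cite: MazurRubin2004, Thm. 5.2.12] -/
theorem kimAtThreeDeepPUB_of_katoPrint_of_facts (hP : cupLogInjective_and_hasDualExp_of_isDeRham)
    (hDR : isDeRham_restrictedRationalTateRep) (hT : exists_smul_range_expStarCoord_iff_trace_log)
    (hS : expStarCoord_eq_zero_iff_kummer) (hT₂ : exists_smul_range_expStarCoord_tower_iff_trace_log)
    (hlev : CarayolLevelEqConductor) :
    N11.KimAtThreeDeepPUB :=
  kimAtThreeDeepPUB_of_katoExact_of_facts (katoExact_of_katoPrint_of_facts hKatoP hP hDR hT)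
    hSak hGZK hPT hP hDR hS hT hT₂ hlev

end Summit.BirchSwinnertonDyer.BirchSwinnertonDyer.Theorems.KimAtThreeDeepUpperOfKatoPrintCrux

end
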